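/-
Copyright (c) 2026 the pub-hodgecm-mathlib formalisation cell (harness21).  Prover seat hodgecm-mathlib-K2Liu-p09 (g6): Track B «K2-LIT»,
hLiu418 = stmt-HodgeConjecture-24832; LEAD F0P6-plan RULING M-158d «A7-val road (σ)», instance layer I-2 (the dictionary of the (A4″-KR) instance: `ρ`, `M_Δ`, `aX`).
-/
import Summits.HodgeConjecture.HodgeConjecture.Theorems.K2LiuDeltaModelRealFrame      -- ★ I-0 p860346 (`reFrame`, `leviAct`, `blkDGL`, bridge)
import Summits.HodgeConjecture.HodgeConjecture.Theorems.K2LiuA7ValuePartnerBlocks     -- ★ I-1b p860356 (`partnerEmbLoc`, blocks of `1 ⊗ g` and of `h ⊗ 1`; brings ★ D-A v1 `tensorEmbLoc`)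
import Summits.HodgeConjecture.HodgeConjecture.Theorems.K2LiuSiegelLeviWeylAlgebra     -- ★ `isUnit_det_blkA_blkD`
import HarnessLib

/-!
# Crux `HLiu418`, road `K2_Liu`, organ A7-val, instance layer I-2: THE DICTIONARY OF THE (A4″-KR) INSTANCE — `ρ` (partner), `M_Δ` (Levi), `aX` (Levi action)

Cell `hodgecm-mathlib`, crux item hLiu418 = `stmt-HodgeConjecture-24832`; squad K2 ∕ K2Liu; prover K2Liu-p09 (g6), organ lead A7-val.  DEFINITION LANE
(`--supports stmt-HodgeConjecture-24832 --as helper`): three DEFINITIONS WITH BODIES + their API; no instance, no notation, no sorry.  These are the by-value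
terms `ρ`, `Γ₁ ∕ mΔ`, `aX` of ★ V8e `K2LiuA7ValueFaceTwo.face_two_of_laws` at the instance of record (K2E5-plan 12:32:27Z (2); ★ I-0 `leviAct` currency):
* §1 **`leviDeltaLoc : Subgroup H_v`** (`H_v = U(𝔻)(L⁺_v)`) — the SIEGEL LEVI `M_Δ = {h | B(h) = C(h) = 0}` (block-diagonal adapted matrix:
  `h` stabilises `ℓ_Δ` AND `ℓ_∇`); `M_Δ ≤ P_Δ` (`isSiegelDelta_of_mem_leviDeltaLoc`).  `mΔ := leviDeltaLoc.subtype`.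
* §2 (the K2Lit CM datum doubled and tensored with `V′ = (L^{M₂}, diag dV′)`, ★ D-A v1 frames `(eW, e′)`) **`rhoLoc v : U(diag dV′)(L⁺_v) →* GL_{L⁺_v}(X_Δ)`**,
  `ρ g := leviAct (D(1 ⊗ g))` — the LINEAR action of the partner group on ★ β-1's Δ-model of the big datum (`D(1 ⊗ g) = reindex epsV (1_n ⊗ₖ G)`, ★ I-1b);
  `rhoLoc_apply_reFrame : ρ g (R b) = R (reindex epsV (1 ⊗ₖ G) *ᵥ b)` (on `n × M₂` matrices `X` over `E ⊗ F_v`: `X ↦ X Gᵀ`), continuity.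
* §3 **`leviRhoLoc v : ↥M_Δ →* GL_{L⁺_v}(X_Δ)`**, `aX m := leviAct (D(m ⊗ 1))` (`D(m ⊗ 1) = reindex epsV (D(m) ⊗ₖ 1)`: `X ↦ D(m) X`), continuity, and
  **`commute_leviRhoLoc_rhoLoc`** (`haXρ` of ★ V8e: the two members of the dual pair commute, ★ I-1b).
The laws `hM` (★ A2c character through the I-0 bridge), `h𝒜G`, `hωG` of ★ V8e on these terms are file I-3.
HONEST LABEL.  `HC_CM` is proved only modulo the 7 printed citations (2 remaining named inputs: hLiu418 = `stmt-HodgeConjecture-24832`,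
h413 = `stmt-HodgeConjecture-24833`) until rung 0 closes.

## References
* [Kudla1994] S. Kudla, Israel J. Math. 87 (1994), §2 (doubled space, Siegel parabolic), §3 Thm. 3.1 (the Siegel Levi and the partner act linearly).
* [MoeglinVignerasWaldspurger1987] C. Mœglin, M.-F. Vignéras, J.-L. Waldspurger, LNM 1291, Chap. 1 I.17, Chap. 2 II.6.
* [HarrisKudlaSweet1996] M. Harris, S. Kudla, W. J. Sweet, J. AMS 9 (1996), §1 (1.11).
-/

set_option autoImplicit false
set_option linter.dupNamespace false -- the mandated namespace repeats `HodgeConjecture.HodgeConjecture`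

noncomputable section

open scoped Matrix Kronecker
open NumberField IsDedekindDomain Matrix Topology
open Literature.NumberTheory.Automorphic Literature.NumberTheory.Automorphic.UnitaryGroup
open Literature.NumberTheory.GelbartRogawski1991 Literature.NumberTheory.GelbartRogawski1991.GRConstruction
open Literature.NumberTheory.GelbartRogawski1991.UnitaryDualPair
open Literature.NumberTheory.GelbartRogawski1991.UnitaryDualPair.LocalSplitting
open Literature.NumberTheory.GelbartRogawski1991.AdaptedBlocks
open Literature.NumberTheory.K2Lit.SiegelDoubled
open Summit.HodgeConjecture.HodgeConjecture.Cruxes.HLiu418.K2LiuLocalSWSectionDefs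
open Summit.HodgeConjecture.HodgeConjecture.Cruxes.HLiu418.K2LiuLocalSWTensorAdaptedBlocks
open Summit.HodgeConjecture.HodgeConjecture.Cruxes.HLiu418.K2LiuDeltaModelRealFrame
open Summit.HodgeConjecture.HodgeConjecture.Cruxes.HLiu418.K2LiuA7ValuePartnerBlocks
open Summit.HodgeConjecture.HodgeConjecture.Cruxes.HLiu418.K2LiuSiegelLeviWeylAlgebra

namespace Summit.HodgeConjecture.HodgeConjecture.Cruxes.HLiu418.K2LiuA7ValueInstanceDefs

/-! ## §1 The Siegel Levi `M_Δ` of `H_v = U(𝔻)(L⁺_v)` -/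

section Levi

variable (L : Type) [Field L] [NumberField L] [IsCMField L]
variable {N M n : ℕ} (e : Fin N × Fin M ≃ Fin n)
  (dV : Fin N → L) (hdV : ∀ i, IsCMField.complexConj L (dV i) = dV i)
  (dW : Fin M → L) (hdW : ∀ i, IsCMField.complexConj L (dW i) = dW i)
variable (v : HeightOneSpectrum (𝓞 (Fp L)))

/-- on `P_Δ`, `X · A(h) = 0 ⇒ X = 0` (`A(h)` is invertible, ★ `isUnit_det_blkA_blkD`). [cite: Kudla1994, §3] -/
theorem eq_zero_of_mul_blkA_eq_zero {h : UnitaryGroup.localPi L (IsCMField.complexConj L) (n + n) (hermD L e dV hdV dW hdW) v}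
    (hC : blkC (matA (Fp L) L (IsCMField.complexConj L) v n h) = 0)
    {X : Matrix (Fin n) (Fin n) (LocalRing L v)} (hX : X * blkA (matA (Fp L) L (IsCMField.complexConj L) v n h) = 0) : X = 0 := by
  have hu := (isUnit_det_blkA_blkD (Fp L) L (IsCMField.complexConj L) v n hC).1
  calc X = X * blkA (matA (Fp L) L (IsCMField.complexConj L) v n h) * (blkA (matA (Fp L) L (IsCMField.complexConj L) v n h))⁻¹ := by
          rw [Matrix.mul_nonsing_inv_cancel_right _ _ hu]
    _ = 0 := by rw [hX, Matrix.zero_mul]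

/-- block-diagonality is preserved by products. [cite: Kudla1994, §3] -/
theorem blkBC_mul_eq_zero {g h : UnitaryGroup.localPi L (IsCMField.complexConj L) (n + n) (hermD L e dV hdV dW hdW) v}
    (hgB : blkB (matA (Fp L) L (IsCMField.complexConj L) v n g) = 0) (hgC : blkC (matA (Fp L) L (IsCMField.complexConj L) v n g) = 0)
    (hhB : blkB (matA (Fp L) L (IsCMField.complexConj L) v n h) = 0) (hhC : blkC (matA (Fp L) L (IsCMField.complexConj L) v n h) = 0) :
    blkB (matA (Fp L) L (IsCMField.complexConj L) v n (g * h)) = 0 ∧ blkC (matA (Fp L) L (IsCMField.complexConj L) v n (g * h)) = 0 := by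
  refine ⟨?_, ?_⟩
  · rw [← matA_mul, blkB_mul, hgB, hhB, Matrix.mul_zero, Matrix.zero_mul, add_zero]
  · rw [← matA_mul, blkC_mul, hgC, hhC, Matrix.mul_zero, Matrix.zero_mul, add_zero]

set_option maxHeartbeats 800000 in -- measured: `h⁻¹` in `U(𝔻)(L⁺_v)` over `L ⊗ L⁺_v` unfolds slowly under unification (cf. ★ β-3 §4)
/-- block-diagonality is preserved by inverses (`A(h)`, `D(h)` invertible on `P_Δ`). [cite: Kudla1994, §3] -/
theorem blkBC_inv_eq_zero {h : UnitaryGroup.localPi L (IsCMField.complexConj L) (n + n) (hermD L e dV hdV dW hdW) v}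
    (hB : blkB (matA (Fp L) L (IsCMField.complexConj L) v n h) = 0) (hC : blkC (matA (Fp L) L (IsCMField.complexConj L) v n h) = 0) :
    blkB (matA (Fp L) L (IsCMField.complexConj L) v n h⁻¹) = 0 ∧ blkC (matA (Fp L) L (IsCMField.complexConj L) v n h⁻¹) = 0 := by
  have hprod : matA (Fp L) L (IsCMField.complexConj L) v n h⁻¹ * matA (Fp L) L (IsCMField.complexConj L) v n h = 1 := by
    rw [matA_mul, inv_mul_cancel, matA_one]
  have hC' : blkC (matA (Fp L) L (IsCMField.complexConj L) v n h⁻¹) = 0 := by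
    have h2 : blkC (matA (Fp L) L (IsCMField.complexConj L) v n h⁻¹) * blkA (matA (Fp L) L (IsCMField.complexConj L) v n h) +
        blkD (matA (Fp L) L (IsCMField.complexConj L) v n h⁻¹) * blkC (matA (Fp L) L (IsCMField.complexConj L) v n h) = 0 := by
      exact (blkC_mul _ _).symm.trans ((congrArg blkC hprod).trans blkC_one)
    have h3 := congrArg (fun X => blkC (matA (Fp L) L (IsCMField.complexConj L) v n h⁻¹) * blkA (matA (Fp L) L (IsCMField.complexConj L) v n h) +
        blkD (matA (Fp L) L (IsCMField.complexConj L) v n h⁻¹) * X) hC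
    simp only [Matrix.mul_zero, add_zero] at h3
    exact eq_zero_of_mul_blkA_eq_zero L e dV hdV dW hdW v hC (h3.symm.trans h2)
  refine ⟨?_, hC'⟩
  have h2 : blkA (matA (Fp L) L (IsCMField.complexConj L) v n h⁻¹) * blkB (matA (Fp L) L (IsCMField.complexConj L) v n h) +
      blkB (matA (Fp L) L (IsCMField.complexConj L) v n h⁻¹) * blkD (matA (Fp L) L (IsCMField.complexConj L) v n h) = 0 := by
    exact (blkB_mul _ _).symm.trans ((congrArg blkB hprod).trans blkB_one)
  have h3 := congrArg (fun X => blkA (matA (Fp L) L (IsCMField.complexConj L) v n h⁻¹) * X +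
      blkB (matA (Fp L) L (IsCMField.complexConj L) v n h⁻¹) * blkD (matA (Fp L) L (IsCMField.complexConj L) v n h)) hB
  simp only [Matrix.mul_zero, zero_add] at h3
  have h1 : blkB (matA (Fp L) L (IsCMField.complexConj L) v n h⁻¹) * blkD (matA (Fp L) L (IsCMField.complexConj L) v n h) = 0 := h3.symm.trans h2
  have hDu := (isUnit_det_blkA_blkD (Fp L) L (IsCMField.complexConj L) v n hC).2
  calc blkB (matA (Fp L) L (IsCMField.complexConj L) v n h⁻¹) =
      blkB (matA (Fp L) L (IsCMField.complexConj L) v n h⁻¹) * blkD (matA (Fp L) L (IsCMField.complexConj L) v n h) *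
        (blkD (matA (Fp L) L (IsCMField.complexConj L) v n h))⁻¹ := by
        rw [Matrix.mul_nonsing_inv_cancel_right _ _ hDu]
    _ = 0 := by rw [h1, Matrix.zero_mul]

/-- **THE SIEGEL LEVI `M_Δ = {h ∈ H_v | B(h) = C(h) = 0}`** of `H_v = U(𝔻)(L⁺_v)` — the elements whose Δ-adapted matrix is block-diagonal, i.e. which stabilise
both `ℓ_Δ` and `ℓ_∇` (`P_Δ ∩ P_∇`; compare ★ `siegelDeltaLoc = {C = 0}`). [cite: Kudla1994, §3] [cite: HarrisKudlaSweet1996, §1 (1.11)] -/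
def leviDeltaLoc : Subgroup (UnitaryGroup.localPi L (IsCMField.complexConj L) (n + n) (hermD L e dV hdV dW hdW) v) where
  carrier := {h | blkB (matA (Fp L) L (IsCMField.complexConj L) v n h) = 0 ∧ blkC (matA (Fp L) L (IsCMField.complexConj L) v n h) = 0}
  one_mem' := ⟨by rw [matA_one, blkB_one], by rw [matA_one, blkC_one]⟩
  mul_mem' hg hh := blkBC_mul_eq_zero L e dV hdV dW hdW v hg.1 hg.2 hh.1 hh.2
  inv_mem' hh := blkBC_inv_eq_zero L e dV hdV dW hdW v hh.1 hh.2

/-- membership in `M_Δ`. [cite: Kudla1994, §3] -/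
theorem mem_leviDeltaLoc_iff (h : UnitaryGroup.localPi L (IsCMField.complexConj L) (n + n) (hermD L e dV hdV dW hdW) v) :
    h ∈ leviDeltaLoc L e dV hdV dW hdW v ↔
      blkB (matA (Fp L) L (IsCMField.complexConj L) v n h) = 0 ∧ blkC (matA (Fp L) L (IsCMField.complexConj L) v n h) = 0 :=
  Iff.rfl

/-- `M_Δ ≤ P_Δ` in the local predicate currency of ★ D10 (`LocalSplitting.IsSiegelDelta`, ★ `isSiegelDelta_iff_blkC_eq_zero`) — the `hmΔ` of ★ V8e with `mΔ := M_Δ.subtype`.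
[cite: Kudla1994, §3] -/
theorem isSiegelDelta_of_mem_leviDeltaLoc [Algebra.IsQuadraticExtension (Fp L) L] {δ : L} (hcδ : IsCMField.complexConj L δ = -δ) (hδ : δ ≠ 0)
    {d : Fp L} (hd : δ * δ = algebraMap (Fp L) L d) {T₀ : Matrix (Fin n) (Fin n) (Fp L)} (hT₀ : T₀.IsSymm)
    (hJD : hermD L e dV hdV dW hdW = (gramD (Fp L) n T₀).map (algebraMap (Fp L) L))
    {h : UnitaryGroup.localPi L (IsCMField.complexConj L) (n + n) (hermD L e dV hdV dW hdW) v} (hh : h ∈ leviDeltaLoc L e dV hdV dW hdW v) :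
    IsSiegelDelta (Fp L) L (IsCMField.complexConj L) hcδ hδ hd v n hT₀ hJD h :=
  (isSiegelDelta_iff_blkC_eq_zero (Fp L) L (IsCMField.complexConj L) hcδ hδ hd v n hT₀ hJD h).2 hh.2

end Levi

/-! ## §2 The `D`-blocks of `1 ⊗ g` and of `m ⊗ 1` as homomorphisms into `GL_{n′}(L ⊗ L⁺_v)`; the actions `ρ`, `aX` -/

section Actions

variable (L : Type) [Field L] [NumberField L] [IsCMField L]
  {δ : L} (hcδ : IsCMField.complexConj L δ = -δ) (hδ : δ ≠ 0)
variable {N M n : ℕ} (e : Fin N × Fin M ≃ Fin n)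
  (dV : Fin N → L) (hdV : ∀ i, IsCMField.complexConj L (dV i) = dV i)
  (dW : Fin M → L) (hdW : ∀ i, IsCMField.complexConj L (dW i) = dW i)
variable {M₂ M' n' : ℕ} (eW : Fin M × Fin M₂ ≃ Fin M') (e' : Fin N × Fin M' ≃ Fin n')
  (dV' : Fin M₂ → L) (hdV' : ∀ k, IsCMField.complexConj L (dV' k) = dV' k)
variable (v : HeightOneSpectrum (𝓞 (Fp L)))

/-- `C(1 ⊗ g) = 0` (★ I-1b), as a named fact. [cite: Kudla1994, §3] -/
theorem blkC_partnerEmbLoc_eq_zero (g : UnitaryGroup.localPi L (IsCMField.complexConj L) M₂ (Matrix.diagonal dV') v) :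
    blkC (matA (Fp L) L (IsCMField.complexConj L) v n' (partnerEmbLoc L e dV hdV dW hdW eW e' dV' hdV' v g)) = 0 :=
  (blk_matA_partnerEmbLoc L e dV hdV dW hdW eW e' dV' hdV' v g).2.2.1

/-- `C((1 ⊗ g)(1 ⊗ g′)) = 0`. [cite: Kudla1994, §3] -/
theorem blkC_partnerEmbLoc_mul_eq_zero (g g' : UnitaryGroup.localPi L (IsCMField.complexConj L) M₂ (Matrix.diagonal dV') v) :
    blkC (matA (Fp L) L (IsCMField.complexConj L) v n'
      (partnerEmbLoc L e dV hdV dW hdW eW e' dV' hdV' v g * partnerEmbLoc L e dV hdV dW hdW eW e' dV' hdV' v g')) = 0 := by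
  rw [← map_mul]
  exact blkC_partnerEmbLoc_eq_zero L e dV hdV dW hdW eW e' dV' hdV' v (g * g')

set_option maxHeartbeats 400000 in
/-- **`g ↦ D(1 ⊗ g) ∈ GL_{n′}(L ⊗ L⁺_v)`** — the `D`-block of the partner embedding as a homomorphism (`1 ⊗ g` is Siegel, ★ I-1b; `D` is multiplicative on
`P_Δ`, ★ I-0 `blkDGL_mul`); its value is `reindex epsV (1_n ⊗ₖ G)` (★ I-1b `blk_matA_partnerEmbLoc`). [cite: Kudla1994, §3] -/
def partnerBlkDHom : UnitaryGroup.localPi L (IsCMField.complexConj L) M₂ (Matrix.diagonal dV') v →* GL (Fin n') (LocalRing L v) where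
  toFun g := blkDGL (Fp L) L (IsCMField.complexConj L) v n' (partnerEmbLoc L e dV hdV dW hdW eW e' dV' hdV' v g)
    (blkC_partnerEmbLoc_eq_zero L e dV hdV dW hdW eW e' dV' hdV' v g)
  map_one' := by
    apply Units.ext
    rw [val_blkDGL, map_one, matA_one, blkD_one, Units.val_one]
  map_mul' g g' := by
    rw [← blkDGL_mul (Fp L) L (IsCMField.complexConj L) v n' (partnerEmbLoc L e dV hdV dW hdW eW e' dV' hdV' v g)
      (partnerEmbLoc L e dV hdV dW hdW eW e' dV' hdV' v g') (blkC_partnerEmbLoc_eq_zero L e dV hdV dW hdW eW e' dV' hdV' v g)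
      (blkC_partnerEmbLoc_eq_zero L e dV hdV dW hdW eW e' dV' hdV' v g') (blkC_partnerEmbLoc_mul_eq_zero L e dV hdV dW hdW eW e' dV' hdV' v g g')]
    apply Units.ext
    rw [val_blkDGL, val_blkDGL, map_mul]

/-- the value of `partnerBlkDHom v g`: `reindex epsV (1_n ⊗ₖ G)`, `G` the matrix of `g` over `L ⊗ L⁺_v`. [cite: Kudla1994, §3] -/
theorem val_partnerBlkDHom (g : UnitaryGroup.localPi L (IsCMField.complexConj L) M₂ (Matrix.diagonal dV') v) :
    (partnerBlkDHom L e dV hdV dW hdW eW e' dV' hdV' v g).val =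
      Matrix.reindex (epsV e eW e') (epsV e eW e')
        ((1 : Matrix (Fin n) (Fin n) (LocalRing L v)) ⊗ₖ ((UnitaryGroup.localGLPiEquiv L M₂ v).symm (g : UnitaryGroup.LocalGLPi L M₂ v)).val) := by
  show (blkDGL (Fp L) L (IsCMField.complexConj L) v n' (partnerEmbLoc L e dV hdV dW hdW eW e' dV' hdV' v g)
    (blkC_partnerEmbLoc_eq_zero L e dV hdV dW hdW eW e' dV' hdV' v g)).val = _
  rw [val_blkDGL, (blk_matA_partnerEmbLoc L e dV hdV dW hdW eW e' dV' hdV' v g).2.2.2]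

/-- `C(m ⊗ 1) = 0` for `m ∈ M_Δ`. [cite: Kudla1994, §3] -/
theorem blkC_tensorEmbLoc_eq_zero_of_mem (m : ↥(leviDeltaLoc L e dV hdV dW hdW v)) :
    blkC (matA (Fp L) L (IsCMField.complexConj L) v n'
      (tensorEmbLoc L e dV hdV dW hdW eW e' dV' hdV' v (m : UnitaryGroup.localPi L (IsCMField.complexConj L) (n + n) (hermD L e dV hdV dW hdW) v))) = 0 :=
  blkC_matA_tensorEmbLoc_eq_zero L e dV hdV dW hdW eW e' dV' hdV' v m.2.2

/-- `C((m ⊗ 1)(m′ ⊗ 1)) = 0` for `m, m′ ∈ M_Δ`. [cite: Kudla1994, §3] -/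
theorem blkC_tensorEmbLoc_mul_eq_zero_of_mem (m m' : ↥(leviDeltaLoc L e dV hdV dW hdW v)) :
    blkC (matA (Fp L) L (IsCMField.complexConj L) v n'
      (tensorEmbLoc L e dV hdV dW hdW eW e' dV' hdV' v (m : UnitaryGroup.localPi L (IsCMField.complexConj L) (n + n) (hermD L e dV hdV dW hdW) v) *
        tensorEmbLoc L e dV hdV dW hdW eW e' dV' hdV' v (m' : UnitaryGroup.localPi L (IsCMField.complexConj L) (n + n) (hermD L e dV hdV dW hdW) v))) = 0 := by
  rw [← map_mul]
  exact blkC_matA_tensorEmbLoc_eq_zero L e dV hdV dW hdW eW e' dV' hdV' v ((leviDeltaLoc L e dV hdV dW hdW v).mul_mem m.2 m'.2).2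

/-- the `D`-block unit of `m ⊗ 1`, `m ∈ M_Δ` (auxiliary; packaged as a homomorphism next). [cite: Kudla1994, §3] -/
def leviBlkD (m : ↥(leviDeltaLoc L e dV hdV dW hdW v)) : GL (Fin n') (LocalRing L v) :=
  blkDGL (Fp L) L (IsCMField.complexConj L) v n'
    (tensorEmbLoc L e dV hdV dW hdW eW e' dV' hdV' v (m : UnitaryGroup.localPi L (IsCMField.complexConj L) (n + n) (hermD L e dV hdV dW hdW) v))
    (blkC_tensorEmbLoc_eq_zero_of_mem L e dV hdV dW hdW eW e' dV' hdV' v m)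

set_option maxHeartbeats 400000 in -- measured: the subgroup coercions of `M_Δ` over `L ⊗ L⁺_v` unfold slowly (as ★ β-3 §4)
/-- **`m ↦ D(m ⊗ 1) ∈ GL_{n′}(L ⊗ L⁺_v)` on the Siegel Levi `M_Δ`** — value `reindex epsV (D(m) ⊗ₖ 1)` (★ I-1b `blkBD_matA_tensorEmbLoc`). [cite: Kudla1994, §3] -/
def leviBlkDHom : ↥(leviDeltaLoc L e dV hdV dW hdW v) →* GL (Fin n') (LocalRing L v) where
  toFun := leviBlkD L e dV hdV dW hdW eW e' dV' hdV' v
  map_one' := by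
    show leviBlkD L e dV hdV dW hdW eW e' dV' hdV' v 1 = 1
    unfold leviBlkD
    apply Units.ext
    rw [val_blkDGL, OneMemClass.coe_one, MonoidHom.map_one, matA_one, blkD_one, Units.val_one]
  map_mul' m m' := by
    show leviBlkD L e dV hdV dW hdW eW e' dV' hdV' v (m * m') = leviBlkD L e dV hdV dW hdW eW e' dV' hdV' v m * leviBlkD L e dV hdV dW hdW eW e' dV' hdV' v m'
    unfold leviBlkD
    rw [← blkDGL_mul (Fp L) L (IsCMField.complexConj L) v n'
      (tensorEmbLoc L e dV hdV dW hdW eW e' dV' hdV' v (m : UnitaryGroup.localPi L (IsCMField.complexConj L) (n + n) (hermD L e dV hdV dW hdW) v))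
      (tensorEmbLoc L e dV hdV dW hdW eW e' dV' hdV' v (m' : UnitaryGroup.localPi L (IsCMField.complexConj L) (n + n) (hermD L e dV hdV dW hdW) v))
      (blkC_tensorEmbLoc_eq_zero_of_mem L e dV hdV dW hdW eW e' dV' hdV' v m) (blkC_tensorEmbLoc_eq_zero_of_mem L e dV hdV dW hdW eW e' dV' hdV' v m')
      (blkC_tensorEmbLoc_mul_eq_zero_of_mem L e dV hdV dW hdW eW e' dV' hdV' v m m')]
    apply Units.ext
    rw [val_blkDGL, val_blkDGL, Subgroup.coe_mul, MonoidHom.map_mul]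

/-- unfolding: `leviBlkDHom v m = leviBlkD v m`. [cite: Kudla1994, §3] -/
theorem leviBlkDHom_apply (m : ↥(leviDeltaLoc L e dV hdV dW hdW v)) :
    leviBlkDHom L e dV hdV dW hdW eW e' dV' hdV' v m = leviBlkD L e dV hdV dW hdW eW e' dV' hdV' v m :=
  rfl

set_option maxHeartbeats 400000 in -- measured: as `leviBlkDHom`
/-- the value of `leviBlkD v m`: `reindex epsV (D(m) ⊗ₖ 1)`. [cite: Kudla1994, §3] -/
theorem val_leviBlkD (m : ↥(leviDeltaLoc L e dV hdV dW hdW v)) :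
    (leviBlkD L e dV hdV dW hdW eW e' dV' hdV' v m).val =
      Matrix.reindex (epsV e eW e') (epsV e eW e')
        (blkD (matA (Fp L) L (IsCMField.complexConj L) v n (m : UnitaryGroup.localPi L (IsCMField.complexConj L) (n + n) (hermD L e dV hdV dW hdW) v)) ⊗ₖ
          (1 : Matrix (Fin M₂) (Fin M₂) (LocalRing L v))) := by
  unfold leviBlkD
  rw [val_blkDGL]
  exact (blkBD_matA_tensorEmbLoc L e dV hdV dW hdW eW e' dV' hdV' v
    (m : UnitaryGroup.localPi L (IsCMField.complexConj L) (n + n) (hermD L e dV hdV dW hdW) v)).2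

set_option maxHeartbeats 400000 in -- measured: as `leviBlkDHom`
/-- **the two `D`-block homomorphisms commute** (`(m ⊗ 1)(1 ⊗ g) = (1 ⊗ g)(m ⊗ 1)`, ★ I-1b). [cite: MoeglinVignerasWaldspurger1987, Chap. 1 I.17] -/
theorem commute_leviBlkDHom_partnerBlkDHom (m : ↥(leviDeltaLoc L e dV hdV dW hdW v))
    (g : UnitaryGroup.localPi L (IsCMField.complexConj L) M₂ (Matrix.diagonal dV') v) :
    Commute (leviBlkDHom L e dV hdV dW hdW eW e' dV' hdV' v m) (partnerBlkDHom L e dV hdV dW hdW eW e' dV' hdV' v g) := by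
  have hCm := blkC_tensorEmbLoc_eq_zero_of_mem L e dV hdV dW hdW eW e' dV' hdV' v m
  have hCg := blkC_partnerEmbLoc_eq_zero L e dV hdV dW hdW eW e' dV' hdV' v g
  have hcomm := commute_tensorEmbLoc_partnerEmbLoc L e dV hdV dW hdW eW e' dV' hdV' v
    (m : UnitaryGroup.localPi L (IsCMField.complexConj L) (n + n) (hermD L e dV hdV dW hdW) v) g
  have hCmg : blkC (matA (Fp L) L (IsCMField.complexConj L) v n'
      (tensorEmbLoc L e dV hdV dW hdW eW e' dV' hdV' v (m : UnitaryGroup.localPi L (IsCMField.complexConj L) (n + n) (hermD L e dV hdV dW hdW) v) *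
        partnerEmbLoc L e dV hdV dW hdW eW e' dV' hdV' v g)) = 0 := by
    rw [← matA_mul, blkC_mul, hCm, hCg, Matrix.zero_mul, Matrix.mul_zero, add_zero]
  have hCgm : blkC (matA (Fp L) L (IsCMField.complexConj L) v n'
      (partnerEmbLoc L e dV hdV dW hdW eW e' dV' hdV' v g *
        tensorEmbLoc L e dV hdV dW hdW eW e' dV' hdV' v (m : UnitaryGroup.localPi L (IsCMField.complexConj L) (n + n) (hermD L e dV hdV dW hdW) v))) = 0 := by
    rw [← hcomm.eq]; exact hCmg
  show leviBlkD L e dV hdV dW hdW eW e' dV' hdV' v m * blkDGL (Fp L) L (IsCMField.complexConj L) v n' _ hCg =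
    blkDGL (Fp L) L (IsCMField.complexConj L) v n' _ hCg * leviBlkD L e dV hdV dW hdW eW e' dV' hdV' v m
  unfold leviBlkD
  rw [← blkDGL_mul (Fp L) L (IsCMField.complexConj L) v n' _ _ hCm hCg hCmg, ← blkDGL_mul (Fp L) L (IsCMField.complexConj L) v n' _ _ hCg hCm hCgm]
  apply Units.ext
  rw [val_blkDGL, val_blkDGL, hcomm.eq]

variable [Algebra.IsQuadraticExtension (Fp L) L]

/-- **`ρ = rhoLoc v : U(diag dV′)(L⁺_v) →* GL_{L⁺_v}(X_Δ)`**, `ρ := leviAct ∘ D(1 ⊗ ·)` — the LINEAR action of the partner group `U(V′_v)` on ★ β-1's Δ-model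
`𝒮(X_Δ)`, `X_Δ = L⁺_v^{n′+n′}`, of the big datum `𝔻 ⊗ V′`; on the real frame `ρ g (R b) = R (reindex epsV (1 ⊗ₖ G) *ᵥ b)` (★ I-0 `leviAct_apply_reFrame` +
`val_partnerBlkDHom`), i.e. `X ↦ X Gᵀ` on `n × M₂` matrices over `L ⊗ L⁺_v`.  The `ρ` of ★ V8e `face_two_of_laws`. [cite: Kudla1994, §3 Thm. 3.1]
[cite: MoeglinVignerasWaldspurger1987, Chap. 2 II.6] -/
def rhoLoc : UnitaryGroup.localPi L (IsCMField.complexConj L) M₂ (Matrix.diagonal dV') v →*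
    ((Fin (n' + n') → v.adicCompletion (Fp L)) ≃ₗ[v.adicCompletion (Fp L)] (Fin (n' + n') → v.adicCompletion (Fp L))) :=
  (leviAct (Fp L) L (IsCMField.complexConj L) hcδ hδ v n').comp (partnerBlkDHom L e dV hdV dW hdW eW e' dV' hdV' v)

/-- unfolding: `ρ g = leviAct (D(1 ⊗ g))`. [cite: Kudla1994, §3 Thm. 3.1] -/
theorem rhoLoc_apply (g : UnitaryGroup.localPi L (IsCMField.complexConj L) M₂ (Matrix.diagonal dV') v) :
    rhoLoc L hcδ hδ e dV hdV dW hdW eW e' dV' hdV' v g =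
      leviAct (Fp L) L (IsCMField.complexConj L) hcδ hδ v n' (partnerBlkDHom L e dV hdV dW hdW eW e' dV' hdV' v g) :=
  rfl

/-- **`aX = leviRhoLoc v : ↥M_Δ →* GL_{L⁺_v}(X_Δ)`**, `aX := leviAct ∘ D(· ⊗ 1)` — the linear action of the Siegel Levi of the SMALL group `H_v = U(𝔻)(L⁺_v)` on
★ β-1's Δ-model of the big datum; `aX m (R b) = R (reindex epsV (D(m) ⊗ₖ 1) *ᵥ b)`, i.e. `X ↦ D(m) X`.  The `aX` of ★ V8e (with `Γ₁ := ↥M_Δ`, `mΔ := M_Δ.subtype`).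
[cite: Kudla1994, §3 Thm. 3.1] [cite: MoeglinVignerasWaldspurger1987, Chap. 2 II.6] -/
def leviRhoLoc : ↥(leviDeltaLoc L e dV hdV dW hdW v) →*
    ((Fin (n' + n') → v.adicCompletion (Fp L)) ≃ₗ[v.adicCompletion (Fp L)] (Fin (n' + n') → v.adicCompletion (Fp L))) :=
  (leviAct (Fp L) L (IsCMField.complexConj L) hcδ hδ v n').comp (leviBlkDHom L e dV hdV dW hdW eW e' dV' hdV' v)

/-- unfolding: `aX m = leviAct (D(m ⊗ 1))`. [cite: Kudla1994, §3 Thm. 3.1] -/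
theorem leviRhoLoc_apply (m : ↥(leviDeltaLoc L e dV hdV dW hdW v)) :
    leviRhoLoc L hcδ hδ e dV hdV dW hdW eW e' dV' hdV' v m =
      leviAct (Fp L) L (IsCMField.complexConj L) hcδ hδ v n' (leviBlkDHom L e dV hdV dW hdW eW e' dV' hdV' v m) :=
  rfl

/-- **`haXρ`: THE LEVI ACTION AND THE PARTNER ACTION COMMUTE** (through `leviAct`, ★ `commute_leviBlkDHom_partnerBlkDHom`). [cite: MoeglinVignerasWaldspurger1987, Chap. 1 I.17] -/
theorem commute_leviRhoLoc_rhoLoc (m : ↥(leviDeltaLoc L e dV hdV dW hdW v))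
    (g : UnitaryGroup.localPi L (IsCMField.complexConj L) M₂ (Matrix.diagonal dV') v) :
    Commute (leviRhoLoc L hcδ hδ e dV hdV dW hdW eW e' dV' hdV' v m) (rhoLoc L hcδ hδ e dV hdV dW hdW eW e' dV' hdV' v g) :=
  (commute_leviBlkDHom_partnerBlkDHom L e dV hdV dW hdW eW e' dV' hdV' v m g).map (leviAct (Fp L) L (IsCMField.complexConj L) hcδ hδ v n')

end Actions

end Summit.HodgeConjecture.HodgeConjecture.Cruxes.HLiu418.K2LiuA7ValueInstanceDefs

end
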